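import Mathlib
import HarnessLib
import Literature.MathematicalPhysics.QuantumLattice.HubbardBandSectorCountingToolbox

/-!
# Route `KLProgramme` — crux K1 `H10TwoPointLimit` (stmt-HubbardSuperconductivity-19938):
# generic polar-grid geometry for sector counting on a PERTURBED Fermi curve

Two curve-generic inputs of the cell / «one determined leg» counts, freed from the free band `ε₀` (the tree's
`BandSectorCounting.chord_lower` / `card_grid_in_box_le` are stated for `bandFermiRadius μ`; the counts on BGM's moving curve
`{ε₀ + δ_h = μ}` — cell gate-hubbard-kl GAP-LEDGER G-002 — need them for an ARBITRARY radius function), plus the Lipschitz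
bound of a perturbation on the closed square from a sup-norm gradient bound:

* `chord_lower_radial` — `4 u_min² sin²((θ - θ')/2) ≤ |p(θ) - p(θ')|²` for `p(θ) = R(θ)(cos θ, sin θ)`, any `R ≥ u_min > 0`
  (no regularity);
* `card_grid_in_box_le_radial` — the grid angles `θ_ω = (ω + ½)w`, `ω < N`, `N w = 2π`, whose points `p(θ_ω)` lie in a box of
  half-side `r` number `≤ 3(2π(√2 r/u_min)/w + 1)` (the tree's proof, verbatim, for an arbitrary `R`);
* `convex_closedSquare`, `lipschitz_of_fderiv_le` — `|δ k - δ k'| ≤ κ₁‖k - k'‖_∞` on `[-π, π]²` from `‖Dδ‖ ≤ κ₁` there.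

Consumed by `KLProgrammeH10TwoPointLimitPerturbedCell.lean`. Everything is PROVED; no definitions. References: BGM 2003
Lemmas 7.2–7.3 [cite: BenfattoGiulianiMastropietro2003]; BGM 2006 App. A3 [cite: BenfattoGiulianiMastropietro2006].
-/

noncomputable section

namespace Summit.HubbardSuperconductivity.HubbardSuperconductivity.Theorems.PerturbedFermiCurve

set_option linter.dupNamespace false -- summit = problem name (single-conjunct summit), D-0017

open Real Set
open Literature.MathematicalPhysics.QuantumLattice Literature.MathematicalPhysics.QuantumLattice.BandSectorCounting

/-! ## §1 Generic polar-grid geometry: chord bound and few grid points in a box -/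

/-- **Chord bound for a polar curve with radii `≥ u_min`**: `4 u_min² sin²((θ - θ')/2) ≤ |p(θ) - p(θ')|²` for
`p(θ) = R(θ)(cos θ, sin θ)`; no regularity of `R` is needed. [folklore] -/
theorem chord_lower_radial {R : ℝ → ℝ} {umin : ℝ} (hup : 0 < umin) {θ θ' : ℝ} (hu : umin ≤ R θ) (hu' : umin ≤ R θ') :
    4 * umin ^ 2 * Real.sin ((θ - θ') / 2) ^ 2 ≤
      (R θ * Real.cos θ - R θ' * Real.cos θ') ^ 2 + (R θ * Real.sin θ - R θ' * Real.sin θ') ^ 2 := by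
  have hcos : Real.cos (θ - θ') = 1 - 2 * Real.sin ((θ - θ') / 2) ^ 2 := by
    have := Real.cos_two_mul_eq_one_sub ((θ - θ') / 2)
    rwa [show 2 * ((θ - θ') / 2) = θ - θ' by ring] at this
  have hid : (R θ * Real.cos θ - R θ' * Real.cos θ') ^ 2 + (R θ * Real.sin θ - R θ' * Real.sin θ') ^ 2 =
      (R θ - R θ') ^ 2 + 4 * (R θ * R θ') * Real.sin ((θ - θ') / 2) ^ 2 := by
    have h3 := Real.cos_sub θ θ'
    have e1 := Real.sin_sq_add_cos_sq θ; have e2 := Real.sin_sq_add_cos_sq θ'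
    linear_combination (R θ) ^ 2 * e1 + (R θ') ^ 2 * e2 + 2 * R θ * R θ' * h3 - 2 * R θ * R θ' * hcos
  rw [hid]
  have hs2 : 0 ≤ Real.sin ((θ - θ') / 2) ^ 2 := sq_nonneg _
  have hprod : umin ^ 2 ≤ R θ * R θ' := by
    rw [sq]; exact mul_le_mul hu hu' hup.le (hup.le.trans hu)
  nlinarith [sq_nonneg (R θ - R θ')]

/-- **Few grid points of a polar curve in a small box**: for `p(θ) = R(θ)(cos θ, sin θ)` with `R ≥ u_min > 0`, the grid
angles `θ_ω = (ω + ½) w`, `ω < N`, `N w = 2π`, whose points lie in a box of half-side `r` number at most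
`3 (2π(√2 r/u_min)/w + 1)` (the tree's `card_grid_in_box_le`, verbatim, for an arbitrary radius function). [folklore] -/
theorem card_grid_in_box_le_radial {R : ℝ → ℝ} {umin : ℝ} (hup : 0 < umin) (hR : ∀ θ, umin ≤ R θ)
    {N : ℕ} {w r x y : ℝ} (hw : 0 < w) (hN : (N : ℝ) * w = 2 * π) (hr : 0 ≤ r) :
    ((((Finset.range N).filter fun ω : ℕ =>
        |R (w / 2 + ω * w) * Real.cos (w / 2 + ω * w) - x| ≤ r ∧
          |R (w / 2 + ω * w) * Real.sin (w / 2 + ω * w) - y| ≤ r).card : ℝ)) ≤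
      3 * (2 * (π * (Real.sqrt 2 * r / umin)) / w + 1) := by
  set S := (Finset.range N).filter fun ω : ℕ =>
    |R (w / 2 + ω * w) * Real.cos (w / 2 + ω * w) - x| ≤ r ∧
      |R (w / 2 + ω * w) * Real.sin (w / 2 + ω * w) - y| ≤ r with hS
  set ε := Real.sqrt 2 * r / umin with hε
  have hε0 : 0 ≤ ε := by positivity
  set d₀ := π * ε with hd₀
  have hd0 : 0 ≤ d₀ := by positivity
  rcases S.eq_empty_or_nonempty with hSe | ⟨ω₀, hω₀⟩
  · rw [hSe]; simp; positivity
  · -- every element is close to `ω₀` modulo `N`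
    have hmem : ∀ ω ∈ S, |((ω : ℝ) - ω₀) * w| ≤ d₀ ∨ |((ω : ℝ) - ω₀) * w - 2 * π| ≤ d₀ ∨
        |((ω : ℝ) - ω₀) * w + 2 * π| ≤ d₀ := by
      intro ω hω
      rw [hS, Finset.mem_filter, Finset.mem_range] at hω hω₀
      set θ := w / 2 + (ω : ℝ) * w with hθ
      set θ₀ := w / 2 + (ω₀ : ℝ) * w with hθ₀
      have hΔ : θ - θ₀ = ((ω : ℝ) - ω₀) * w := by rw [hθ, hθ₀]; ring
      have hdx : |R θ * Real.cos θ - R θ₀ * Real.cos θ₀| ≤ 2 * r := by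
        calc |R θ * Real.cos θ - R θ₀ * Real.cos θ₀| = |(R θ * Real.cos θ - x) - (R θ₀ * Real.cos θ₀ - x)| := by ring_nf
          _ ≤ |R θ * Real.cos θ - x| + |R θ₀ * Real.cos θ₀ - x| := abs_sub _ _
          _ ≤ 2 * r := by linarith [hω.2.1, hω₀.2.1]
      have hdy : |R θ * Real.sin θ - R θ₀ * Real.sin θ₀| ≤ 2 * r := by
        calc |R θ * Real.sin θ - R θ₀ * Real.sin θ₀| = |(R θ * Real.sin θ - y) - (R θ₀ * Real.sin θ₀ - y)| := by ring_nf
          _ ≤ |R θ * Real.sin θ - y| + |R θ₀ * Real.sin θ₀ - y| := abs_sub _ _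
          _ ≤ 2 * r := by linarith [hω.2.2, hω₀.2.2]
      have hch := chord_lower_radial hup (hR θ) (hR θ₀)
      have hsq : Real.sin ((θ - θ₀) / 2) ^ 2 ≤ ε ^ 2 := by
        have hx2 : (R θ * Real.cos θ - R θ₀ * Real.cos θ₀) ^ 2 ≤ (2 * r) ^ 2 := by
          rw [← sq_abs]; exact pow_le_pow_left₀ (abs_nonneg _) hdx 2
        have hy2 : (R θ * Real.sin θ - R θ₀ * Real.sin θ₀) ^ 2 ≤ (2 * r) ^ 2 := by
          rw [← sq_abs]; exact pow_le_pow_left₀ (abs_nonneg _) hdy 2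
        have : 4 * umin ^ 2 * Real.sin ((θ - θ₀) / 2) ^ 2 ≤ 8 * r ^ 2 := by nlinarith
        rw [hε, div_pow, mul_pow, Real.sq_sqrt (by norm_num : (0:ℝ) ≤ 2), le_div_iff₀ (by positivity)]
        nlinarith
      have hsin : |Real.sin ((θ - θ₀) / 2)| ≤ ε := by
        rw [← Real.sqrt_sq hε0, ← Real.sqrt_sq (abs_nonneg (Real.sin ((θ - θ₀) / 2))), sq_abs]
        exact Real.sqrt_le_sqrt hsq
      -- `|θ - θ₀| ≤ 2π`
      have hωN : (ω : ℝ) < N := by exact_mod_cast hω.1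
      have hω₀N : (ω₀ : ℝ) < N := by exact_mod_cast hω₀.1
      have hb1 : (ω : ℝ) * w < 2 * π := by
        calc (ω : ℝ) * w < N * w := mul_lt_mul_of_pos_right hωN hw
          _ = 2 * π := hN
      have hb2 : (ω₀ : ℝ) * w < 2 * π := by
        calc (ω₀ : ℝ) * w < N * w := mul_lt_mul_of_pos_right hω₀N hw
          _ = 2 * π := hN
      have hb3 : 0 ≤ (ω : ℝ) * w := by positivity
      have hb4 : 0 ≤ (ω₀ : ℝ) * w := by positivity
      have hΔ2 : |θ - θ₀| ≤ 2 * π := by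
        rw [hΔ, show ((ω : ℝ) - ω₀) * w = ω * w - ω₀ * w by ring, abs_le]; constructor <;> linarith
      have hlt : |(θ - θ₀) / 2| ≤ π := by
        rw [abs_div, abs_two]; linarith
      have habs : |θ - θ₀| = 2 * |(θ - θ₀) / 2| := by rw [abs_div, abs_two]; ring
      rcases near_zero_or_pi_of_abs_sin_le hlt hsin with hsmall | hlarge
      · left
        rw [← hΔ, habs, hd₀]; linarith
      · right
        rw [← hΔ]
        have h2 : 2 * π - |θ - θ₀| ≤ d₀ := by rw [habs, hd₀]; linarith
        rcases le_or_gt 0 (θ - θ₀) with hpos | hneg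
        · left
          rw [abs_of_nonneg hpos] at h2 hΔ2
          rw [abs_of_nonpos (by linarith : θ - θ₀ - 2 * π ≤ 0)]; linarith
        · right
          rw [abs_of_neg hneg] at h2 hΔ2
          rw [abs_of_nonneg (by linarith : 0 ≤ θ - θ₀ + 2 * π)]; linarith
    -- the three classes
    have hcl : ∀ c : ℝ, (((S.filter fun ω : ℕ => |((ω : ℝ) - ω₀) * w - c| ≤ d₀).card : ℝ)) ≤ 2 * d₀ / w + 1 := by
      intro c
      refine natCard_le_of_diam (by positivity) fun i hi j hj => ?_
      rw [Finset.mem_filter] at hi hj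
      have h1 := hi.2; have h2 := hj.2
      rw [le_div_iff₀ hw]
      have : ((j : ℝ) - i) * w = (((j : ℝ) - ω₀) * w - c) - (((i : ℝ) - ω₀) * w - c) := by ring
      rw [this]
      calc _ ≤ |(((j : ℝ) - ω₀) * w - c) - (((i : ℝ) - ω₀) * w - c)| := le_abs_self _
        _ ≤ |((j : ℝ) - ω₀) * w - c| + |((i : ℝ) - ω₀) * w - c| := abs_sub _ _
        _ ≤ 2 * d₀ := by linarith
    set S₁ := S.filter fun ω : ℕ => |((ω : ℝ) - ω₀) * w - 0| ≤ d₀ with hS₁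
    set S₂ := S.filter fun ω : ℕ => |((ω : ℝ) - ω₀) * w - 2 * π| ≤ d₀ with hS₂
    set S₃ := S.filter fun ω : ℕ => |((ω : ℝ) - ω₀) * w - (-(2 * π))| ≤ d₀ with hS₃
    have hsub : S ⊆ S₁ ∪ (S₂ ∪ S₃) := by
      intro ω hω
      rcases hmem ω hω with h | h | h
      · exact Finset.mem_union_left _ (Finset.mem_filter.2 ⟨hω, by simpa using h⟩)
      · exact Finset.mem_union_right _ (Finset.mem_union_left _ (Finset.mem_filter.2 ⟨hω, h⟩))
      · exact Finset.mem_union_right _ (Finset.mem_union_right _ (Finset.mem_filter.2 ⟨hω, by rwa [sub_neg_eq_add]⟩))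
    have hcard : (S.card : ℝ) ≤ (S₁.card : ℝ) + ((S₂.card : ℝ) + (S₃.card : ℝ)) := by
      have h0 := Finset.card_le_card hsub
      have h1 := Finset.card_union_le S₁ (S₂ ∪ S₃)
      have h2 := Finset.card_union_le S₂ S₃
      have : S.card ≤ S₁.card + (S₂.card + S₃.card) := h0.trans (h1.trans (Nat.add_le_add_left h2 _))
      exact_mod_cast this
    calc (S.card : ℝ) ≤ (S₁.card : ℝ) + ((S₂.card : ℝ) + (S₃.card : ℝ)) := hcard
      _ ≤ (2 * d₀ / w + 1) + ((2 * d₀ / w + 1) + (2 * d₀ / w + 1)) := add_le_add (hcl 0) (add_le_add (hcl _) (hcl _))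
      _ = 3 * (2 * (π * ε) / w + 1) := by rw [hd₀]; ring

/-! ## §2 Lipschitz bound on the closed square from a gradient bound -/

/-- The closed square `[-π, π]²` is convex. [folklore] -/
theorem convex_closedSquare : Convex ℝ {k : Fin 2 → ℝ | ∀ i, |k i| ≤ π} := by
  intro x hx y hy s t hs ht hst
  simp only [Set.mem_setOf_eq] at hx hy ⊢
  intro i
  simp only [Pi.add_apply, Pi.smul_apply, smul_eq_mul]
  calc |s * x i + t * y i| ≤ |s * x i| + |t * y i| := abs_add_le _ _
    _ = s * |x i| + t * |y i| := by rw [abs_mul, abs_mul, abs_of_nonneg hs, abs_of_nonneg ht]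
    _ ≤ s * π + t * π := add_le_add (mul_le_mul_of_nonneg_left (hx i) hs) (mul_le_mul_of_nonneg_left (hy i) ht)
    _ = π := by rw [← add_mul, hst, one_mul]

/-- **A sup-norm gradient bound on the closed square gives the Lipschitz bound there**: if `δ` is differentiable at every
point of the closed square with `‖Dδ‖ ≤ κ₁`, then `|δ k - δ k'| ≤ κ₁ ‖k - k'‖_∞` for `k, k'` in the square. [folklore] -/
theorem lipschitz_of_fderiv_le {δ : (Fin 2 → ℝ) → ℝ} {κ₁ : ℝ}
    (hd : ∀ k : Fin 2 → ℝ, (∀ i, |k i| ≤ π) → DifferentiableAt ℝ δ k)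
    (hκ : ∀ k : Fin 2 → ℝ, (∀ i, |k i| ≤ π) → ‖fderiv ℝ δ k‖ ≤ κ₁) {k k' : Fin 2 → ℝ}
    (hk : ∀ i, |k i| ≤ π) (hk' : ∀ i, |k' i| ≤ π) : |δ k - δ k'| ≤ κ₁ * ‖k - k'‖ := by
  have h := convex_closedSquare.norm_image_sub_le_of_norm_hasFDerivWithin_le
    (f := δ) (f' := fun k => fderiv ℝ δ k) (fun z hz => (hd z hz).hasFDerivAt.hasFDerivWithinAt) hκ hk' hk
  rwa [Real.norm_eq_abs] at h

end Summit.HubbardSuperconductivity.HubbardSuperconductivity.Theorems.PerturbedFermiCurve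

end
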